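import Summits.BirchSwinnertonDyer.Rank1Residual.X10.MuZeroRoadThree
import HarnessLib

/-!
# Class X10b (N2), the `μ`-ZERO ROAD at `p = 3`: per-cell kernel RECORDS, part C — X_A3 AT THE PAIR
# (`MazurMainConjecture W 3`) MODULO Greenberg's `μ = 0` at the pair (and the booked `BSD(E,3)`), for 11
# rank-`0` N2 cells WITHOUT a trivial road (140777f1, 143888d1, 149248h1, 150272c1, 150272d1, 153328a1, 153328b1, 153410b1, 153760a1, 153760d1, 153760l1)
# (cell `b2b-bsdres`, unit `b2b-bsdres-x10` = N2 class lead, GEN 34; records — theorems only, no definition,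
# no named fact, nothing booked)

HONEST FRAMING (run/shared/lean/b2b/bsd-rank1-residual/, verbatim in every file): the goal of the
cell is to DELETE the COMBINATION-SHAPED residual classes of the Birch–Swinnerton-Dyer formula for
ALL analytic-rank `≤ 1` elliptic curves over `ℚ` — "full BSD formula for every rank `≤ 1` curve in
class `C`" assembled STRICTLY from published theorems — so that the rank-`≤ 1` remainder becomes
exactly the CONSTRUCTION-SHAPED classes, which are TYPED (missing-input `Prop`s), NOT attempted.
This is not "finishing BSD". Class X10b keeps its label CONSTRUCTION-SHAPED (NEEDS X_A3, RESIDUAL-MAP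
§I N2); nothing is booked by this file (the lane books, the referee rules); everything is PER PAIR; no
census number moves.

## What (x10 GEN 34, X10-AUDIT §40; `class-closure/N2/MU-ROAD-x10g34.md`)

After GEN 24–27, 180 of the 313 N2 cells carry X_A3 (`MazurMainConjecture W 3`) AT THE PAIR in the
kernel by a TRIVIAL road (unit cell / CM partner / Tamagawa-free unit partner), and GEN 27 proved that
NO trivial road can exist for the other 133 rank-`0` cells (102 anomalous non-K-CM, 25 parity-odd,
6 Ш-cells; `TRIVIAL-ROADS-x10g27.tsv`, column `road_g24 = NONE`). For each such cell `E` below (Cremona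
model `[a₁,…,a₆]`; IN THE KERNEL (`decide`): `3 ∤ Δ`, the schema count `countPoints [a₁,…,a₆] 3 = n₃ = #Ẽ(𝔽₃)`
(`X11b.natCard_point_eq_countPoints`) with `3 ∤ 4 − n₃` — ordinary, here mostly ANOMALOUS `n₃ ∈ {3, 6}` —, and a
Frobenius witness `ℓ`: `countPoints [a₁,…,a₆] ℓ = n = #Ẽ(𝔽_ℓ)`, `X² − (ℓ+1−n)X + ℓ` root-free mod `3`, so `E[3]` is
irreducible, Mazur 1978 Prop. 6.3 (1)) this file records, by the GEN 34
TOOL `X10/MuZeroRoad{,Three}.lean` (Kato Thm. 17.4 **(2)** + Greenberg's `μ = 0` ⟹ the INTEGRAL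
divisibility; chain with Greenberg's Thm. 4.1):
* `mazurMainConjecture_e<label>_of_greenbergMu` — **X_A3 AT THE PAIR, `MazurMainConjecture W 3`**, MODULO
  `hμ` = Greenberg's Conj. 1.11 at `(E,3)` (every cyclotomic datum; OPEN) and `hbsd : BSDp W 3` (Miller's
  `BSD(E,3)` — booked for the pair by the lane's certificates, R146.1 / R171.3; a DISPLAYED hypothesis
  here, not re-derived); displayed PUBLISHED binders `hkato` (Kato 2004 Thm. 17.4, clause (2) used),
  `hS` (Schneider 1985 / BMS Thm. 1.7, odd `p`) + `hMT` (Mazur–Stein–Tate σ, odd `p`) for Greenberg's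
  Thm. 4.1, `hGZK`, `h3` (period unit at `3`); census binder `hL` (`L(E,1) ≠ 0`: analytic rank `0`).
  (The Euler-system half `ord₃ #Ш ≤ ord₃ #Ш_an` modulo `hμ` alone is the CLASS-level
  `missingUpperBoundAt_three_of_greenbergMu` of the TOOL; per pair it is weaker than the booked
  certificate and is not recorded.)
READING: at every rank-`0` N2 cell the per-pair residue of X_A3 is now EXACTLY Greenberg's `μ = 0` at the
pair (a property of `ρ̄_{E,3}` on its good-ordinary congruence class, Greenberg–Vatsal Thm. (1.4)); the
class-level statement is untouched; NO Yan–Zhu, NO partner, NO CM, NO `μ`-certificate. Data / script: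
`HOME/b2b-bsdres-x10/g34/gen/mkmurecords.py` (stdlib; Cremona ecdata via GEN 24's `n2data.json`).

References: [Kato2004Asterisque] Thm. 17.4 (2); [GreenbergLNM1716] Conj. 1.11, Thm. 4.1; [GreenbergVatsal2000]
p. 2, Prop. (3.7), Thm. (1.4); [Mazur1978] Prop. 6.3 (1), Cor. 4.1; [Miller2011LMS] Def. 1.1; [Cremona2006] tables.
-/

set_option autoImplicit false

noncomputable section

open scoped Classical MatrixGroups ModularForm

open CongruenceSubgroup WeierstrassCurve Literature.NumberTheory.EllipticCurves
  Literature.NumberTheory.EllipticCurves.ModularForms Literature.NumberTheory.EllipticCurves.Rank1Residual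
  Literature.NumberTheory.EllipticCurves.Rank1Residual.X11RankOneCertificates
  Summit.BirchSwinnertonDyer.BirchSwinnertonDyer.Rank1Residual.IntModel
  Summit.BirchSwinnertonDyer.BirchSwinnertonDyer.Rank1Residual.X11RankOne
  Summit.BirchSwinnertonDyer.BirchSwinnertonDyer.Theorems.Rank1ResidualX1Defs

namespace Summit.BirchSwinnertonDyer.Rank1Residual.X10.MuZeroRoad

/-! ### `140777f1` (3Nn, N = 140777, NOGO-parity) -/

/-- **X_A3 AT THE PAIR `(140777f1, 3)` by the `μ`-ZERO ROAD: `MazurMainConjecture W 3` MODULO Greenberg's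
`μ = 0` at the pair (`hμ`, Conj. 1.11, OPEN) and `BSD(E,3)` (`hbsd : BSDp W 3`, booked for the pair by the lane's
certificates; displayed, not re-derived).** Cremona model `[1, 1, 0, 9292, 6426295]`, `N = 140777 = 7^2·13^2·17`; census image `3Nn`;
GEN 27 verdict `NOGO-parity` (`dim S⁰(E)` odd: every Tamagawa-`3`-free good-at-`3` partner has odd `3`-Selmer rank); IN THE KERNEL: `3 ∤ Δ`, `#Ẽ(𝔽₃) = 5` (`countPoints`; `a₃ = -1`: good
ORDINARY, non-anomalous), Frobenius witness `ℓ = 5`: `ℓ ∤ Δ`, `#Ẽ(𝔽_{5}) = 2` (`a_{5} = 4`), `X² − a_{5}X + 5`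
root-free mod `3` (`E[3]` irreducible). Cremona `allbsd`: analytic rank `0`, `#E(ℚ)_tors = 1`, `∏ c_ℓ = 12`,
`#Ш_an = 1`. Displayed binders: PUBLISHED `hkato` (Kato 17.4, clause (2) used), `hS` + `hMT` (Greenberg 4.1 at odd `p`),
`hGZK`, `h3`; census `hL` (`L(E,1) ≠ 0`), `hbsd`; HYPOTHESIS `hμ`. NO Yan–Zhu, NO partner, NO CM, NO `μ`-certificate.
Per pair; the class-level statement stays OPEN; nothing booked. [cite: Kato2004Asterisque, Thm. 17.4 (2) (p. 273)]
[cite: GreenbergLNM1716, §1 Conj. 1.11 and §5 (closing examples)] [cite: Mazur1978, §6 Prop. 6.3 (1) (p. 153)]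
[cite: Miller2011LMS, Def. 1.1 (arXiv:1010.2431 p. 3)] [cite: Cremona2006, Table 1 (Cremona label 140777f1)] -/
theorem mazurMainConjecture_e140777f1_of_greenbergMu
    (hkato : ∀ (W : WeierstrassCurve ℚ) [W.IsElliptic] [W.IsGloballyMinimal] (p : ℕ) [Fact p.Prime]
      (κ : ZpExtension ℚ p) (γ : Field.absoluteGaloisGroup ℚ) (N : ℕ) [NeZero N]
      (f : CuspForm (Gamma0 N) 2), kato_divisibility W p (κ := κ) (γ := γ) (f := f))
    (hS : Schneider1985_order_charGenerator_odd) (hMT : mazur_tate_sigma_exists_odd)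
    (hGZK : rank_eq_analyticRank_of_analyticRank_le_one) (h3 : realPeriodRat_eq_unit_mul_plusPeriod_three)
    (W : WeierstrassCurve ℚ) [W.IsElliptic] [W.IsGloballyMinimal] [Fact (Nat.Prime 3)]
    (hI : integralModelInt W = ⟨1, 1, 0, 9292, 6426295⟩) (hL : W.entireLFunction 1 ≠ 0)
    (hμ : ∀ (κ : ZpExtension ℚ 3) (γ : Field.absoluteGaloisGroup ℚ),
        κ.IsCyclotomic → κ.IsTopGenerator γ → IsCyclotomicVariable 3 γ →
      ∀ (D : W.SelmerDualData κ γ), D.mu = 0)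
    (hbsd : BSDp W 3) : MazurMainConjecture W 3 :=
  haveI : Fact (Nat.Prime 5) := ⟨by norm_num⟩
  mazurMainConjecture_three_of_ainvs_of_greenbergMu_of_bsdp hkato hS hMT hGZK h3 1 1 0 9292 6426295 hI
    5 2 5 (by decide +kernel) (by decide +kernel) (by decide) (by decide) (by decide) (by decide +kernel)
    (by decide +kernel) (by decide +kernel) hL hμ hbsd

/-! ### `143888d1` (3Ns, N = 143888, NOGO-parity) -/

/-- **X_A3 AT THE PAIR `(143888d1, 3)` by the `μ`-ZERO ROAD: `MazurMainConjecture W 3` MODULO Greenberg's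
`μ = 0` at the pair (`hμ`, Conj. 1.11, OPEN) and `BSD(E,3)` (`hbsd : BSDp W 3`, booked for the pair by the lane's
certificates; displayed, not re-derived).** Cremona model `[0, -1, 0, -9145528, 12504333680]`, `N = 143888 = 2^4·17·23^2`; census image `3Ns`;
GEN 27 verdict `NOGO-parity` (`dim S⁰(E)` odd: every Tamagawa-`3`-free good-at-`3` partner has odd `3`-Selmer rank); IN THE KERNEL: `3 ∤ Δ`, `#Ẽ(𝔽₃) = 5` (`countPoints`; `a₃ = -1`: good
ORDINARY, non-anomalous), Frobenius witness `ℓ = 7`: `ℓ ∤ Δ`, `#Ẽ(𝔽_{7}) = 5` (`a_{7} = 3`), `X² − a_{7}X + 7`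
root-free mod `3` (`E[3]` irreducible). Cremona `allbsd`: analytic rank `0`, `#E(ℚ)_tors = 1`, `∏ c_ℓ = 12`,
`#Ш_an = 1`. Displayed binders: PUBLISHED `hkato` (Kato 17.4, clause (2) used), `hS` + `hMT` (Greenberg 4.1 at odd `p`),
`hGZK`, `h3`; census `hL` (`L(E,1) ≠ 0`), `hbsd`; HYPOTHESIS `hμ`. NO Yan–Zhu, NO partner, NO CM, NO `μ`-certificate.
Per pair; the class-level statement stays OPEN; nothing booked. [cite: Kato2004Asterisque, Thm. 17.4 (2) (p. 273)]
[cite: GreenbergLNM1716, §1 Conj. 1.11 and §5 (closing examples)] [cite: Mazur1978, §6 Prop. 6.3 (1) (p. 153)]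
[cite: Miller2011LMS, Def. 1.1 (arXiv:1010.2431 p. 3)] [cite: Cremona2006, Table 1 (Cremona label 143888d1)] -/
theorem mazurMainConjecture_e143888d1_of_greenbergMu
    (hkato : ∀ (W : WeierstrassCurve ℚ) [W.IsElliptic] [W.IsGloballyMinimal] (p : ℕ) [Fact p.Prime]
      (κ : ZpExtension ℚ p) (γ : Field.absoluteGaloisGroup ℚ) (N : ℕ) [NeZero N]
      (f : CuspForm (Gamma0 N) 2), kato_divisibility W p (κ := κ) (γ := γ) (f := f))
    (hS : Schneider1985_order_charGenerator_odd) (hMT : mazur_tate_sigma_exists_odd)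
    (hGZK : rank_eq_analyticRank_of_analyticRank_le_one) (h3 : realPeriodRat_eq_unit_mul_plusPeriod_three)
    (W : WeierstrassCurve ℚ) [W.IsElliptic] [W.IsGloballyMinimal] [Fact (Nat.Prime 3)]
    (hI : integralModelInt W = ⟨0, (-1), 0, (-9145528), 12504333680⟩) (hL : W.entireLFunction 1 ≠ 0)
    (hμ : ∀ (κ : ZpExtension ℚ 3) (γ : Field.absoluteGaloisGroup ℚ),
        κ.IsCyclotomic → κ.IsTopGenerator γ → IsCyclotomicVariable 3 γ →
      ∀ (D : W.SelmerDualData κ γ), D.mu = 0)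
    (hbsd : BSDp W 3) : MazurMainConjecture W 3 :=
  haveI : Fact (Nat.Prime 7) := ⟨by norm_num⟩
  mazurMainConjecture_three_of_ainvs_of_greenbergMu_of_bsdp hkato hS hMT hGZK h3 0 (-1) 0 (-9145528) 12504333680 hI
    7 5 5 (by decide +kernel) (by decide +kernel) (by decide) (by decide) (by decide) (by decide +kernel)
    (by decide +kernel) (by decide +kernel) hL hμ hbsd

/-! ### `149248h1` (3Ns, N = 149248, NOGO-anomalous) -/

/-- **X_A3 AT THE PAIR `(149248h1, 3)` by the `μ`-ZERO ROAD: `MazurMainConjecture W 3` MODULO Greenberg's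
`μ = 0` at the pair (`hμ`, Conj. 1.11, OPEN) and `BSD(E,3)` (`hbsd : BSDp W 3`, booked for the pair by the lane's
certificates; displayed, not re-derived).** Cremona model `[0, 1, 0, -659, 16433]`, `N = 149248 = 2^8·11·53`; census image `3Ns`;
GEN 27 verdict `NOGO-anomalous` (anomalous: `a₃ ≡ 1 (mod 3)`, constant on the congruence class — no unit partner anywhere); IN THE KERNEL: `3 ∤ Δ`, `#Ẽ(𝔽₃) = 3` (`countPoints`; `a₃ = 1`: good
ORDINARY, ANOMALOUS), Frobenius witness `ℓ = 7`: `ℓ ∤ Δ`, `#Ẽ(𝔽_{7}) = 8` (`a_{7} = 0`), `X² − a_{7}X + 7`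
root-free mod `3` (`E[3]` irreducible). Cremona `allbsd`: analytic rank `0`, `#E(ℚ)_tors = 1`, `∏ c_ℓ = 6`,
`#Ш_an = 1`. Displayed binders: PUBLISHED `hkato` (Kato 17.4, clause (2) used), `hS` + `hMT` (Greenberg 4.1 at odd `p`),
`hGZK`, `h3`; census `hL` (`L(E,1) ≠ 0`), `hbsd`; HYPOTHESIS `hμ`. NO Yan–Zhu, NO partner, NO CM, NO `μ`-certificate.
Per pair; the class-level statement stays OPEN; nothing booked. [cite: Kato2004Asterisque, Thm. 17.4 (2) (p. 273)]
[cite: GreenbergLNM1716, §1 Conj. 1.11 and §5 (closing examples)] [cite: Mazur1978, §6 Prop. 6.3 (1) (p. 153)]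
[cite: Miller2011LMS, Def. 1.1 (arXiv:1010.2431 p. 3)] [cite: Cremona2006, Table 1 (Cremona label 149248h1)] -/
theorem mazurMainConjecture_e149248h1_of_greenbergMu
    (hkato : ∀ (W : WeierstrassCurve ℚ) [W.IsElliptic] [W.IsGloballyMinimal] (p : ℕ) [Fact p.Prime]
      (κ : ZpExtension ℚ p) (γ : Field.absoluteGaloisGroup ℚ) (N : ℕ) [NeZero N]
      (f : CuspForm (Gamma0 N) 2), kato_divisibility W p (κ := κ) (γ := γ) (f := f))
    (hS : Schneider1985_order_charGenerator_odd) (hMT : mazur_tate_sigma_exists_odd)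
    (hGZK : rank_eq_analyticRank_of_analyticRank_le_one) (h3 : realPeriodRat_eq_unit_mul_plusPeriod_three)
    (W : WeierstrassCurve ℚ) [W.IsElliptic] [W.IsGloballyMinimal] [Fact (Nat.Prime 3)]
    (hI : integralModelInt W = ⟨0, 1, 0, (-659), 16433⟩) (hL : W.entireLFunction 1 ≠ 0)
    (hμ : ∀ (κ : ZpExtension ℚ 3) (γ : Field.absoluteGaloisGroup ℚ),
        κ.IsCyclotomic → κ.IsTopGenerator γ → IsCyclotomicVariable 3 γ →
      ∀ (D : W.SelmerDualData κ γ), D.mu = 0)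
    (hbsd : BSDp W 3) : MazurMainConjecture W 3 :=
  haveI : Fact (Nat.Prime 7) := ⟨by norm_num⟩
  mazurMainConjecture_three_of_ainvs_of_greenbergMu_of_bsdp hkato hS hMT hGZK h3 0 1 0 (-659) 16433 hI
    7 8 3 (by decide +kernel) (by decide +kernel) (by decide) (by decide) (by decide) (by decide +kernel)
    (by decide +kernel) (by decide +kernel) hL hμ hbsd

/-! ### `150272c1` (3Ns, N = 150272, NOGO-anomalous) -/

/-- **X_A3 AT THE PAIR `(150272c1, 3)` by the `μ`-ZERO ROAD: `MazurMainConjecture W 3` MODULO Greenberg's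
`μ = 0` at the pair (`hμ`, Conj. 1.11, OPEN) and `BSD(E,3)` (`hbsd : BSDp W 3`, booked for the pair by the lane's
certificates; displayed, not re-derived).** Cremona model `[0, 1, 0, -1551147, -744097031]`, `N = 150272 = 2^8·587`; census image `3Ns`;
GEN 27 verdict `NOGO-anomalous` (anomalous: `a₃ ≡ 1 (mod 3)`, constant on the congruence class — no unit partner anywhere); IN THE KERNEL: `3 ∤ Δ`, `#Ẽ(𝔽₃) = 6` (`countPoints`; `a₃ = -2`: good
ORDINARY, ANOMALOUS), Frobenius witness `ℓ = 7`: `ℓ ∤ Δ`, `#Ẽ(𝔽_{7}) = 8` (`a_{7} = 0`), `X² − a_{7}X + 7`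
root-free mod `3` (`E[3]` irreducible). Cremona `allbsd`: analytic rank `0`, `#E(ℚ)_tors = 1`, `∏ c_ℓ = 6`,
`#Ш_an = 4`. Displayed binders: PUBLISHED `hkato` (Kato 17.4, clause (2) used), `hS` + `hMT` (Greenberg 4.1 at odd `p`),
`hGZK`, `h3`; census `hL` (`L(E,1) ≠ 0`), `hbsd`; HYPOTHESIS `hμ`. NO Yan–Zhu, NO partner, NO CM, NO `μ`-certificate.
Per pair; the class-level statement stays OPEN; nothing booked. [cite: Kato2004Asterisque, Thm. 17.4 (2) (p. 273)]
[cite: GreenbergLNM1716, §1 Conj. 1.11 and §5 (closing examples)] [cite: Mazur1978, §6 Prop. 6.3 (1) (p. 153)]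
[cite: Miller2011LMS, Def. 1.1 (arXiv:1010.2431 p. 3)] [cite: Cremona2006, Table 1 (Cremona label 150272c1)] -/
theorem mazurMainConjecture_e150272c1_of_greenbergMu
    (hkato : ∀ (W : WeierstrassCurve ℚ) [W.IsElliptic] [W.IsGloballyMinimal] (p : ℕ) [Fact p.Prime]
      (κ : ZpExtension ℚ p) (γ : Field.absoluteGaloisGroup ℚ) (N : ℕ) [NeZero N]
      (f : CuspForm (Gamma0 N) 2), kato_divisibility W p (κ := κ) (γ := γ) (f := f))
    (hS : Schneider1985_order_charGenerator_odd) (hMT : mazur_tate_sigma_exists_odd)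
    (hGZK : rank_eq_analyticRank_of_analyticRank_le_one) (h3 : realPeriodRat_eq_unit_mul_plusPeriod_three)
    (W : WeierstrassCurve ℚ) [W.IsElliptic] [W.IsGloballyMinimal] [Fact (Nat.Prime 3)]
    (hI : integralModelInt W = ⟨0, 1, 0, (-1551147), (-744097031)⟩) (hL : W.entireLFunction 1 ≠ 0)
    (hμ : ∀ (κ : ZpExtension ℚ 3) (γ : Field.absoluteGaloisGroup ℚ),
        κ.IsCyclotomic → κ.IsTopGenerator γ → IsCyclotomicVariable 3 γ →
      ∀ (D : W.SelmerDualData κ γ), D.mu = 0)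
    (hbsd : BSDp W 3) : MazurMainConjecture W 3 :=
  haveI : Fact (Nat.Prime 7) := ⟨by norm_num⟩
  mazurMainConjecture_three_of_ainvs_of_greenbergMu_of_bsdp hkato hS hMT hGZK h3 0 1 0 (-1551147) (-744097031) hI
    7 8 6 (by decide +kernel) (by decide +kernel) (by decide) (by decide) (by decide) (by decide +kernel)
    (by decide +kernel) (by decide +kernel) hL hμ hbsd

/-! ### `150272d1` (3Ns, N = 150272, NOGO-anomalous) -/

/-- **X_A3 AT THE PAIR `(150272d1, 3)` by the `μ`-ZERO ROAD: `MazurMainConjecture W 3` MODULO Greenberg's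
`μ = 0` at the pair (`hμ`, Conj. 1.11, OPEN) and `BSD(E,3)` (`hbsd : BSDp W 3`, booked for the pair by the lane's
certificates; displayed, not re-derived).** Cremona model `[0, 1, 0, -6204589, 5946571659]`, `N = 150272 = 2^8·587`; census image `3Ns`;
GEN 27 verdict `NOGO-anomalous` (anomalous: `a₃ ≡ 1 (mod 3)`, constant on the congruence class — no unit partner anywhere); IN THE KERNEL: `3 ∤ Δ`, `#Ẽ(𝔽₃) = 6` (`countPoints`; `a₃ = -2`: good
ORDINARY, ANOMALOUS), Frobenius witness `ℓ = 7`: `ℓ ∤ Δ`, `#Ẽ(𝔽_{7}) = 8` (`a_{7} = 0`), `X² − a_{7}X + 7`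
root-free mod `3` (`E[3]` irreducible). Cremona `allbsd`: analytic rank `0`, `#E(ℚ)_tors = 1`, `∏ c_ℓ = 6`,
`#Ш_an = 1`. Displayed binders: PUBLISHED `hkato` (Kato 17.4, clause (2) used), `hS` + `hMT` (Greenberg 4.1 at odd `p`),
`hGZK`, `h3`; census `hL` (`L(E,1) ≠ 0`), `hbsd`; HYPOTHESIS `hμ`. NO Yan–Zhu, NO partner, NO CM, NO `μ`-certificate.
Per pair; the class-level statement stays OPEN; nothing booked. [cite: Kato2004Asterisque, Thm. 17.4 (2) (p. 273)]
[cite: GreenbergLNM1716, §1 Conj. 1.11 and §5 (closing examples)] [cite: Mazur1978, §6 Prop. 6.3 (1) (p. 153)]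
[cite: Miller2011LMS, Def. 1.1 (arXiv:1010.2431 p. 3)] [cite: Cremona2006, Table 1 (Cremona label 150272d1)] -/
theorem mazurMainConjecture_e150272d1_of_greenbergMu
    (hkato : ∀ (W : WeierstrassCurve ℚ) [W.IsElliptic] [W.IsGloballyMinimal] (p : ℕ) [Fact p.Prime]
      (κ : ZpExtension ℚ p) (γ : Field.absoluteGaloisGroup ℚ) (N : ℕ) [NeZero N]
      (f : CuspForm (Gamma0 N) 2), kato_divisibility W p (κ := κ) (γ := γ) (f := f))
    (hS : Schneider1985_order_charGenerator_odd) (hMT : mazur_tate_sigma_exists_odd)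
    (hGZK : rank_eq_analyticRank_of_analyticRank_le_one) (h3 : realPeriodRat_eq_unit_mul_plusPeriod_three)
    (W : WeierstrassCurve ℚ) [W.IsElliptic] [W.IsGloballyMinimal] [Fact (Nat.Prime 3)]
    (hI : integralModelInt W = ⟨0, 1, 0, (-6204589), 5946571659⟩) (hL : W.entireLFunction 1 ≠ 0)
    (hμ : ∀ (κ : ZpExtension ℚ 3) (γ : Field.absoluteGaloisGroup ℚ),
        κ.IsCyclotomic → κ.IsTopGenerator γ → IsCyclotomicVariable 3 γ →
      ∀ (D : W.SelmerDualData κ γ), D.mu = 0)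
    (hbsd : BSDp W 3) : MazurMainConjecture W 3 :=
  haveI : Fact (Nat.Prime 7) := ⟨by norm_num⟩
  mazurMainConjecture_three_of_ainvs_of_greenbergMu_of_bsdp hkato hS hMT hGZK h3 0 1 0 (-6204589) 5946571659 hI
    7 8 6 (by decide +kernel) (by decide +kernel) (by decide) (by decide) (by decide) (by decide +kernel)
    (by decide +kernel) (by decide +kernel) hL hμ hbsd

/-! ### `153328a1` (3Ns, N = 153328, NOGO-anomalous) -/

/-- **X_A3 AT THE PAIR `(153328a1, 3)` by the `μ`-ZERO ROAD: `MazurMainConjecture W 3` MODULO Greenberg's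
`μ = 0` at the pair (`hμ`, Conj. 1.11, OPEN) and `BSD(E,3)` (`hbsd : BSDp W 3`, booked for the pair by the lane's
certificates; displayed, not re-derived).** Cremona model `[0, 1, 0, -1080597, -781121789]`, `N = 153328 = 2^4·7·37^2`; census image `3Ns`;
GEN 27 verdict `NOGO-anomalous` (anomalous: `a₃ ≡ 1 (mod 3)`, constant on the congruence class — no unit partner anywhere); IN THE KERNEL: `3 ∤ Δ`, `#Ẽ(𝔽₃) = 6` (`countPoints`; `a₃ = -2`: good
ORDINARY, ANOMALOUS), Frobenius witness `ℓ = 13`: `ℓ ∤ Δ`, `#Ẽ(𝔽_{13}) = 17` (`a_{13} = -3`), `X² − a_{13}X + 13`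
root-free mod `3` (`E[3]` irreducible). Cremona `allbsd`: analytic rank `0`, `#E(ℚ)_tors = 1`, `∏ c_ℓ = 6`,
`#Ш_an = 1`. Displayed binders: PUBLISHED `hkato` (Kato 17.4, clause (2) used), `hS` + `hMT` (Greenberg 4.1 at odd `p`),
`hGZK`, `h3`; census `hL` (`L(E,1) ≠ 0`), `hbsd`; HYPOTHESIS `hμ`. NO Yan–Zhu, NO partner, NO CM, NO `μ`-certificate.
Per pair; the class-level statement stays OPEN; nothing booked. [cite: Kato2004Asterisque, Thm. 17.4 (2) (p. 273)]
[cite: GreenbergLNM1716, §1 Conj. 1.11 and §5 (closing examples)] [cite: Mazur1978, §6 Prop. 6.3 (1) (p. 153)]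
[cite: Miller2011LMS, Def. 1.1 (arXiv:1010.2431 p. 3)] [cite: Cremona2006, Table 1 (Cremona label 153328a1)] -/
theorem mazurMainConjecture_e153328a1_of_greenbergMu
    (hkato : ∀ (W : WeierstrassCurve ℚ) [W.IsElliptic] [W.IsGloballyMinimal] (p : ℕ) [Fact p.Prime]
      (κ : ZpExtension ℚ p) (γ : Field.absoluteGaloisGroup ℚ) (N : ℕ) [NeZero N]
      (f : CuspForm (Gamma0 N) 2), kato_divisibility W p (κ := κ) (γ := γ) (f := f))
    (hS : Schneider1985_order_charGenerator_odd) (hMT : mazur_tate_sigma_exists_odd)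
    (hGZK : rank_eq_analyticRank_of_analyticRank_le_one) (h3 : realPeriodRat_eq_unit_mul_plusPeriod_three)
    (W : WeierstrassCurve ℚ) [W.IsElliptic] [W.IsGloballyMinimal] [Fact (Nat.Prime 3)]
    (hI : integralModelInt W = ⟨0, 1, 0, (-1080597), (-781121789)⟩) (hL : W.entireLFunction 1 ≠ 0)
    (hμ : ∀ (κ : ZpExtension ℚ 3) (γ : Field.absoluteGaloisGroup ℚ),
        κ.IsCyclotomic → κ.IsTopGenerator γ → IsCyclotomicVariable 3 γ →
      ∀ (D : W.SelmerDualData κ γ), D.mu = 0)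
    (hbsd : BSDp W 3) : MazurMainConjecture W 3 :=
  haveI : Fact (Nat.Prime 13) := ⟨by norm_num⟩
  mazurMainConjecture_three_of_ainvs_of_greenbergMu_of_bsdp hkato hS hMT hGZK h3 0 1 0 (-1080597) (-781121789) hI
    13 17 6 (by decide +kernel) (by decide +kernel) (by decide) (by decide) (by decide) (by decide +kernel)
    (by decide +kernel) (by decide +kernel) hL hμ hbsd

/-! ### `153328b1` (3Ns, N = 153328, NOGO-anomalous) -/

/-- **X_A3 AT THE PAIR `(153328b1, 3)` by the `μ`-ZERO ROAD: `MazurMainConjecture W 3` MODULO Greenberg's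
`μ = 0` at the pair (`hμ`, Conj. 1.11, OPEN) and `BSD(E,3)` (`hbsd : BSDp W 3`, booked for the pair by the lane's
certificates; displayed, not re-derived).** Cremona model `[0, 1, 0, -789, -15677]`, `N = 153328 = 2^4·7·37^2`; census image `3Ns`;
GEN 27 verdict `NOGO-anomalous` (anomalous: `a₃ ≡ 1 (mod 3)`, constant on the congruence class — no unit partner anywhere); IN THE KERNEL: `3 ∤ Δ`, `#Ẽ(𝔽₃) = 6` (`countPoints`; `a₃ = -2`: good
ORDINARY, ANOMALOUS), Frobenius witness `ℓ = 13`: `ℓ ∤ Δ`, `#Ẽ(𝔽_{13}) = 11` (`a_{13} = 3`), `X² − a_{13}X + 13`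
root-free mod `3` (`E[3]` irreducible). Cremona `allbsd`: analytic rank `0`, `#E(ℚ)_tors = 1`, `∏ c_ℓ = 6`,
`#Ш_an = 1`. Displayed binders: PUBLISHED `hkato` (Kato 17.4, clause (2) used), `hS` + `hMT` (Greenberg 4.1 at odd `p`),
`hGZK`, `h3`; census `hL` (`L(E,1) ≠ 0`), `hbsd`; HYPOTHESIS `hμ`. NO Yan–Zhu, NO partner, NO CM, NO `μ`-certificate.
Per pair; the class-level statement stays OPEN; nothing booked. [cite: Kato2004Asterisque, Thm. 17.4 (2) (p. 273)]
[cite: GreenbergLNM1716, §1 Conj. 1.11 and §5 (closing examples)] [cite: Mazur1978, §6 Prop. 6.3 (1) (p. 153)]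
[cite: Miller2011LMS, Def. 1.1 (arXiv:1010.2431 p. 3)] [cite: Cremona2006, Table 1 (Cremona label 153328b1)] -/
theorem mazurMainConjecture_e153328b1_of_greenbergMu
    (hkato : ∀ (W : WeierstrassCurve ℚ) [W.IsElliptic] [W.IsGloballyMinimal] (p : ℕ) [Fact p.Prime]
      (κ : ZpExtension ℚ p) (γ : Field.absoluteGaloisGroup ℚ) (N : ℕ) [NeZero N]
      (f : CuspForm (Gamma0 N) 2), kato_divisibility W p (κ := κ) (γ := γ) (f := f))
    (hS : Schneider1985_order_charGenerator_odd) (hMT : mazur_tate_sigma_exists_odd)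
    (hGZK : rank_eq_analyticRank_of_analyticRank_le_one) (h3 : realPeriodRat_eq_unit_mul_plusPeriod_three)
    (W : WeierstrassCurve ℚ) [W.IsElliptic] [W.IsGloballyMinimal] [Fact (Nat.Prime 3)]
    (hI : integralModelInt W = ⟨0, 1, 0, (-789), (-15677)⟩) (hL : W.entireLFunction 1 ≠ 0)
    (hμ : ∀ (κ : ZpExtension ℚ 3) (γ : Field.absoluteGaloisGroup ℚ),
        κ.IsCyclotomic → κ.IsTopGenerator γ → IsCyclotomicVariable 3 γ →
      ∀ (D : W.SelmerDualData κ γ), D.mu = 0)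
    (hbsd : BSDp W 3) : MazurMainConjecture W 3 :=
  haveI : Fact (Nat.Prime 13) := ⟨by norm_num⟩
  mazurMainConjecture_three_of_ainvs_of_greenbergMu_of_bsdp hkato hS hMT hGZK h3 0 1 0 (-789) (-15677) hI
    13 11 6 (by decide +kernel) (by decide +kernel) (by decide) (by decide) (by decide) (by decide +kernel)
    (by decide +kernel) (by decide +kernel) hL hμ hbsd

/-! ### `153410b1` (3Ns, N = 153410, NOGO-anomalous) -/

/-- **X_A3 AT THE PAIR `(153410b1, 3)` by the `μ`-ZERO ROAD: `MazurMainConjecture W 3` MODULO Greenberg's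
`μ = 0` at the pair (`hμ`, Conj. 1.11, OPEN) and `BSD(E,3)` (`hbsd : BSDp W 3`, booked for the pair by the lane's
certificates; displayed, not re-derived).** Cremona model `[1, 0, 0, -22575615, -41287095775]`, `N = 153410 = 2·5·23^2·29`; census image `3Ns`;
GEN 27 verdict `NOGO-anomalous` (anomalous: `a₃ ≡ 1 (mod 3)`, constant on the congruence class — no unit partner anywhere); IN THE KERNEL: `3 ∤ Δ`, `#Ẽ(𝔽₃) = 3` (`countPoints`; `a₃ = 1`: good
ORDINARY, ANOMALOUS), Frobenius witness `ℓ = 7`: `ℓ ∤ Δ`, `#Ẽ(𝔽_{7}) = 8` (`a_{7} = 0`), `X² − a_{7}X + 7`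
root-free mod `3` (`E[3]` irreducible). Cremona `allbsd`: analytic rank `0`, `#E(ℚ)_tors = 1`, `∏ c_ℓ = 18`,
`#Ш_an = 1`. Displayed binders: PUBLISHED `hkato` (Kato 17.4, clause (2) used), `hS` + `hMT` (Greenberg 4.1 at odd `p`),
`hGZK`, `h3`; census `hL` (`L(E,1) ≠ 0`), `hbsd`; HYPOTHESIS `hμ`. NO Yan–Zhu, NO partner, NO CM, NO `μ`-certificate.
Per pair; the class-level statement stays OPEN; nothing booked. [cite: Kato2004Asterisque, Thm. 17.4 (2) (p. 273)]
[cite: GreenbergLNM1716, §1 Conj. 1.11 and §5 (closing examples)] [cite: Mazur1978, §6 Prop. 6.3 (1) (p. 153)]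
[cite: Miller2011LMS, Def. 1.1 (arXiv:1010.2431 p. 3)] [cite: Cremona2006, Table 1 (Cremona label 153410b1)] -/
theorem mazurMainConjecture_e153410b1_of_greenbergMu
    (hkato : ∀ (W : WeierstrassCurve ℚ) [W.IsElliptic] [W.IsGloballyMinimal] (p : ℕ) [Fact p.Prime]
      (κ : ZpExtension ℚ p) (γ : Field.absoluteGaloisGroup ℚ) (N : ℕ) [NeZero N]
      (f : CuspForm (Gamma0 N) 2), kato_divisibility W p (κ := κ) (γ := γ) (f := f))
    (hS : Schneider1985_order_charGenerator_odd) (hMT : mazur_tate_sigma_exists_odd)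
    (hGZK : rank_eq_analyticRank_of_analyticRank_le_one) (h3 : realPeriodRat_eq_unit_mul_plusPeriod_three)
    (W : WeierstrassCurve ℚ) [W.IsElliptic] [W.IsGloballyMinimal] [Fact (Nat.Prime 3)]
    (hI : integralModelInt W = ⟨1, 0, 0, (-22575615), (-41287095775)⟩) (hL : W.entireLFunction 1 ≠ 0)
    (hμ : ∀ (κ : ZpExtension ℚ 3) (γ : Field.absoluteGaloisGroup ℚ),
        κ.IsCyclotomic → κ.IsTopGenerator γ → IsCyclotomicVariable 3 γ →
      ∀ (D : W.SelmerDualData κ γ), D.mu = 0)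
    (hbsd : BSDp W 3) : MazurMainConjecture W 3 :=
  haveI : Fact (Nat.Prime 7) := ⟨by norm_num⟩
  mazurMainConjecture_three_of_ainvs_of_greenbergMu_of_bsdp hkato hS hMT hGZK h3 1 0 0 (-22575615) (-41287095775) hI
    7 8 3 (by decide +kernel) (by decide +kernel) (by decide) (by decide) (by decide) (by decide +kernel)
    (by decide +kernel) (by decide +kernel) hL hμ hbsd

/-! ### `153760a1` (3Nn, N = 153760, NOGO-anomalous) -/

/-- **X_A3 AT THE PAIR `(153760a1, 3)` by the `μ`-ZERO ROAD: `MazurMainConjecture W 3` MODULO Greenberg's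
`μ = 0` at the pair (`hμ`, Conj. 1.11, OPEN) and `BSD(E,3)` (`hbsd : BSDp W 3`, booked for the pair by the lane's
certificates; displayed, not re-derived).** Cremona model `[0, 1, 0, -1250, -19352]`, `N = 153760 = 2^5·5·31^2`; census image `3Nn`;
GEN 27 verdict `NOGO-anomalous` (anomalous: `a₃ ≡ 1 (mod 3)`, constant on the congruence class — no unit partner anywhere); IN THE KERNEL: `3 ∤ Δ`, `#Ẽ(𝔽₃) = 6` (`countPoints`; `a₃ = -2`: good
ORDINARY, ANOMALOUS), Frobenius witness `ℓ = 7`: `ℓ ∤ Δ`, `#Ẽ(𝔽_{7}) = 8` (`a_{7} = 0`), `X² − a_{7}X + 7`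
root-free mod `3` (`E[3]` irreducible). Cremona `allbsd`: analytic rank `0`, `#E(ℚ)_tors = 2`, `∏ c_ℓ = 24`,
`#Ш_an = 1`. Displayed binders: PUBLISHED `hkato` (Kato 17.4, clause (2) used), `hS` + `hMT` (Greenberg 4.1 at odd `p`),
`hGZK`, `h3`; census `hL` (`L(E,1) ≠ 0`), `hbsd`; HYPOTHESIS `hμ`. NO Yan–Zhu, NO partner, NO CM, NO `μ`-certificate.
Per pair; the class-level statement stays OPEN; nothing booked. [cite: Kato2004Asterisque, Thm. 17.4 (2) (p. 273)]
[cite: GreenbergLNM1716, §1 Conj. 1.11 and §5 (closing examples)] [cite: Mazur1978, §6 Prop. 6.3 (1) (p. 153)]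
[cite: Miller2011LMS, Def. 1.1 (arXiv:1010.2431 p. 3)] [cite: Cremona2006, Table 1 (Cremona label 153760a1)] -/
theorem mazurMainConjecture_e153760a1_of_greenbergMu
    (hkato : ∀ (W : WeierstrassCurve ℚ) [W.IsElliptic] [W.IsGloballyMinimal] (p : ℕ) [Fact p.Prime]
      (κ : ZpExtension ℚ p) (γ : Field.absoluteGaloisGroup ℚ) (N : ℕ) [NeZero N]
      (f : CuspForm (Gamma0 N) 2), kato_divisibility W p (κ := κ) (γ := γ) (f := f))
    (hS : Schneider1985_order_charGenerator_odd) (hMT : mazur_tate_sigma_exists_odd)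
    (hGZK : rank_eq_analyticRank_of_analyticRank_le_one) (h3 : realPeriodRat_eq_unit_mul_plusPeriod_three)
    (W : WeierstrassCurve ℚ) [W.IsElliptic] [W.IsGloballyMinimal] [Fact (Nat.Prime 3)]
    (hI : integralModelInt W = ⟨0, 1, 0, (-1250), (-19352)⟩) (hL : W.entireLFunction 1 ≠ 0)
    (hμ : ∀ (κ : ZpExtension ℚ 3) (γ : Field.absoluteGaloisGroup ℚ),
        κ.IsCyclotomic → κ.IsTopGenerator γ → IsCyclotomicVariable 3 γ →
      ∀ (D : W.SelmerDualData κ γ), D.mu = 0)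
    (hbsd : BSDp W 3) : MazurMainConjecture W 3 :=
  haveI : Fact (Nat.Prime 7) := ⟨by norm_num⟩
  mazurMainConjecture_three_of_ainvs_of_greenbergMu_of_bsdp hkato hS hMT hGZK h3 0 1 0 (-1250) (-19352) hI
    7 8 6 (by decide +kernel) (by decide +kernel) (by decide) (by decide) (by decide) (by decide +kernel)
    (by decide +kernel) (by decide +kernel) hL hμ hbsd

/-! ### `153760d1` (3Nn, N = 153760, NOGO-parity) -/

/-- **X_A3 AT THE PAIR `(153760d1, 3)` by the `μ`-ZERO ROAD: `MazurMainConjecture W 3` MODULO Greenberg's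
`μ = 0` at the pair (`hμ`, Conj. 1.11, OPEN) and `BSD(E,3)` (`hbsd : BSDp W 3`, booked for the pair by the lane's
certificates; displayed, not re-derived).** Cremona model `[0, -1, 0, -21245, -1184843]`, `N = 153760 = 2^5·5·31^2`; census image `3Nn`;
GEN 27 verdict `NOGO-parity` (`dim S⁰(E)` odd: every Tamagawa-`3`-free good-at-`3` partner has odd `3`-Selmer rank); IN THE KERNEL: `3 ∤ Δ`, `#Ẽ(𝔽₃) = 5` (`countPoints`; `a₃ = -1`: good
ORDINARY, non-anomalous), Frobenius witness `ℓ = 7`: `ℓ ∤ Δ`, `#Ẽ(𝔽_{7}) = 8` (`a_{7} = 0`), `X² − a_{7}X + 7`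
root-free mod `3` (`E[3]` irreducible). Cremona `allbsd`: analytic rank `0`, `#E(ℚ)_tors = 1`, `∏ c_ℓ = 12`,
`#Ш_an = 1`. Displayed binders: PUBLISHED `hkato` (Kato 17.4, clause (2) used), `hS` + `hMT` (Greenberg 4.1 at odd `p`),
`hGZK`, `h3`; census `hL` (`L(E,1) ≠ 0`), `hbsd`; HYPOTHESIS `hμ`. NO Yan–Zhu, NO partner, NO CM, NO `μ`-certificate.
Per pair; the class-level statement stays OPEN; nothing booked. [cite: Kato2004Asterisque, Thm. 17.4 (2) (p. 273)]
[cite: GreenbergLNM1716, §1 Conj. 1.11 and §5 (closing examples)] [cite: Mazur1978, §6 Prop. 6.3 (1) (p. 153)]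
[cite: Miller2011LMS, Def. 1.1 (arXiv:1010.2431 p. 3)] [cite: Cremona2006, Table 1 (Cremona label 153760d1)] -/
theorem mazurMainConjecture_e153760d1_of_greenbergMu
    (hkato : ∀ (W : WeierstrassCurve ℚ) [W.IsElliptic] [W.IsGloballyMinimal] (p : ℕ) [Fact p.Prime]
      (κ : ZpExtension ℚ p) (γ : Field.absoluteGaloisGroup ℚ) (N : ℕ) [NeZero N]
      (f : CuspForm (Gamma0 N) 2), kato_divisibility W p (κ := κ) (γ := γ) (f := f))
    (hS : Schneider1985_order_charGenerator_odd) (hMT : mazur_tate_sigma_exists_odd)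
    (hGZK : rank_eq_analyticRank_of_analyticRank_le_one) (h3 : realPeriodRat_eq_unit_mul_plusPeriod_three)
    (W : WeierstrassCurve ℚ) [W.IsElliptic] [W.IsGloballyMinimal] [Fact (Nat.Prime 3)]
    (hI : integralModelInt W = ⟨0, (-1), 0, (-21245), (-1184843)⟩) (hL : W.entireLFunction 1 ≠ 0)
    (hμ : ∀ (κ : ZpExtension ℚ 3) (γ : Field.absoluteGaloisGroup ℚ),
        κ.IsCyclotomic → κ.IsTopGenerator γ → IsCyclotomicVariable 3 γ →
      ∀ (D : W.SelmerDualData κ γ), D.mu = 0)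
    (hbsd : BSDp W 3) : MazurMainConjecture W 3 :=
  haveI : Fact (Nat.Prime 7) := ⟨by norm_num⟩
  mazurMainConjecture_three_of_ainvs_of_greenbergMu_of_bsdp hkato hS hMT hGZK h3 0 (-1) 0 (-21245) (-1184843) hI
    7 8 5 (by decide +kernel) (by decide +kernel) (by decide) (by decide) (by decide) (by decide +kernel)
    (by decide +kernel) (by decide +kernel) hL hμ hbsd

/-! ### `153760l1` (3Nn, N = 153760, NOGO-anomalous) -/

/-- **X_A3 AT THE PAIR `(153760l1, 3)` by the `μ`-ZERO ROAD: `MazurMainConjecture W 3` MODULO Greenberg's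
`μ = 0` at the pair (`hμ`, Conj. 1.11, OPEN) and `BSD(E,3)` (`hbsd : BSDp W 3`, booked for the pair by the lane's
certificates; displayed, not re-derived).** Cremona model `[0, 1, 0, -20416765, 35501824363]`, `N = 153760 = 2^5·5·31^2`; census image `3Nn`;
GEN 27 verdict `NOGO-anomalous` (anomalous: `a₃ ≡ 1 (mod 3)`, constant on the congruence class — no unit partner anywhere); IN THE KERNEL: `3 ∤ Δ`, `#Ẽ(𝔽₃) = 3` (`countPoints`; `a₃ = 1`: good
ORDINARY, ANOMALOUS), Frobenius witness `ℓ = 7`: `ℓ ∤ Δ`, `#Ẽ(𝔽_{7}) = 8` (`a_{7} = 0`), `X² − a_{7}X + 7`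
root-free mod `3` (`E[3]` irreducible). Cremona `allbsd`: analytic rank `0`, `#E(ℚ)_tors = 1`, `∏ c_ℓ = 12`,
`#Ш_an = 1`. Displayed binders: PUBLISHED `hkato` (Kato 17.4, clause (2) used), `hS` + `hMT` (Greenberg 4.1 at odd `p`),
`hGZK`, `h3`; census `hL` (`L(E,1) ≠ 0`), `hbsd`; HYPOTHESIS `hμ`. NO Yan–Zhu, NO partner, NO CM, NO `μ`-certificate.
Per pair; the class-level statement stays OPEN; nothing booked. [cite: Kato2004Asterisque, Thm. 17.4 (2) (p. 273)]
[cite: GreenbergLNM1716, §1 Conj. 1.11 and §5 (closing examples)] [cite: Mazur1978, §6 Prop. 6.3 (1) (p. 153)]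
[cite: Miller2011LMS, Def. 1.1 (arXiv:1010.2431 p. 3)] [cite: Cremona2006, Table 1 (Cremona label 153760l1)] -/
theorem mazurMainConjecture_e153760l1_of_greenbergMu
    (hkato : ∀ (W : WeierstrassCurve ℚ) [W.IsElliptic] [W.IsGloballyMinimal] (p : ℕ) [Fact p.Prime]
      (κ : ZpExtension ℚ p) (γ : Field.absoluteGaloisGroup ℚ) (N : ℕ) [NeZero N]
      (f : CuspForm (Gamma0 N) 2), kato_divisibility W p (κ := κ) (γ := γ) (f := f))
    (hS : Schneider1985_order_charGenerator_odd) (hMT : mazur_tate_sigma_exists_odd)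
    (hGZK : rank_eq_analyticRank_of_analyticRank_le_one) (h3 : realPeriodRat_eq_unit_mul_plusPeriod_three)
    (W : WeierstrassCurve ℚ) [W.IsElliptic] [W.IsGloballyMinimal] [Fact (Nat.Prime 3)]
    (hI : integralModelInt W = ⟨0, 1, 0, (-20416765), 35501824363⟩) (hL : W.entireLFunction 1 ≠ 0)
    (hμ : ∀ (κ : ZpExtension ℚ 3) (γ : Field.absoluteGaloisGroup ℚ),
        κ.IsCyclotomic → κ.IsTopGenerator γ → IsCyclotomicVariable 3 γ →
      ∀ (D : W.SelmerDualData κ γ), D.mu = 0)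
    (hbsd : BSDp W 3) : MazurMainConjecture W 3 :=
  haveI : Fact (Nat.Prime 7) := ⟨by norm_num⟩
  mazurMainConjecture_three_of_ainvs_of_greenbergMu_of_bsdp hkato hS hMT hGZK h3 0 1 0 (-20416765) 35501824363 hI
    7 8 3 (by decide +kernel) (by decide +kernel) (by decide) (by decide) (by decide) (by decide +kernel)
    (by decide +kernel) (by decide +kernel) hL hμ hbsd

end Summit.BirchSwinnertonDyer.Rank1Residual.X10.MuZeroRoad

end
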